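import Literature.AnabelianGeometry.AbsoluteAnabelian.AbsTopIII.BiAnabelianStarOverERefPairs
import Literature.AnabelianGeometry.AbsoluteAnabelian.AbsTopIII.BiAnabelianCompatibilityCores

/-!
# [AbsTopIII] Cor. 3.7 (iii), second clause — ONE family realising the `𝔈`-cores AND the `𝒳`-core

[cite: MochizukiAbsTopIII2015, Cor 3.7 (i) p.87] [cite: MochizukiAbsTopIII2015, Cor 3.7 (iii) p.88]

abc-iut-L4-t5 (gen 5), row «COR37-COMPAT-LITERAL», step (1) of HOME/staging/L4/L4-t5/DISCHARGE-PLAN-Cor37-compat.md: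
the **glue family** `K₁` on `𝒟*` — boundary set `E_{{𝔈, 𝒳}}` (pairs through `𝔈` or through `𝒳`; saturated for
free by abc-iut-L4-t2's `isSaturated_univE`), homotopies `K₀`'s on pairs ending at `𝔈` and the IDENTITY (`eqToHom`
of `pathFunctor_comp_eq_of_through_ref`) on the other pairs, which go through `𝒳`; the family laws hold because the
two prescriptions AGREE on common pairs (`coresFamily_η_eq_eqToHom_of_through_ref`, p446533). `K₁` contains
(Def. 3.5 (ii), along the embeddings of `BiAnabelianCompatibility.lean`) the core structures on `(𝒟*, 𝔈)`,
`(𝒟†_{≤4}, 𝔈)` AND `(𝒟‡_{≤1}, 𝒳)`: `exists_realises_cores_and_refCore` — three of the four conjuncts of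
`RealisesCoresAndLogObs` (Cor. 3.7 (iii), second clause) realised by ONE family, for EVERY setting, with NO
inductive gluing. The fourth conjunct (`𝔖†_log`) needs an `ι`-over-Galois hypothesis (plan, step (2)).
Honest framing: model-level bookkeeping; nothing here bears on [IUTchIII] Cor. 3.12.
-/

set_option autoImplicit false

namespace Literature.AnabelianGeometry.AbsoluteAnabelian.AbsTopIII

open CategoryTheory Quiver
open Literature.AnabelianGeometry.AbsoluteAnabelian.DiagramOfCategories

universe u

namespace BiAnabelianSetting

variable {X E N : Type u} [Category.{u} X] [Category.{u} E] [Category.{u} N]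
  (𝔖 : BiAnabelianSetting X E N)

/-! ## Pairs through `𝔈` or through `𝒳` -/

/-- The two core vertices `𝔈`, `𝒳` of `𝒟*`. [cite: MochizukiAbsTopIII2015, Cor 3.7 (i) p.87] -/
def coreVertices₂ : Cor37Vertex → Prop := fun v => v = .galois ∨ v = .ref

/-- `𝔈` has no outgoing edges in `Γ⃗_{𝒟*}`. [cite: MochizukiAbsTopIII2015, Cor 3.7 (ii) p.87] -/
theorem isEmpty_hom_galois (b : Cor37Vertex) : IsEmpty (Cor37Vertex.galois ⟶ b) :=
  ⟨fun e => by cases e⟩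

/-- The boundary set of `K₀` is "all co-verticial pairs ending at `𝔈`". [cite: MochizukiAbsTopIII2015, Cor 3.7 (ii) p.88] -/
theorem coresFamily_E_iff {a b : Cor37Vertex} (P Q : Path a b) :
    𝔖.coresFamily.E P Q ↔ b = .galois := by
  refine ⟨fun ⟨d⟩ => ?_, fun hb => ?_⟩
  · obtain ⟨w, hw, p, q, s, -, -⟩ := d
    cases hw
    exact eq_of_path_of_isEmpty_hom isEmpty_hom_galois s
  · subst hb
    exact univE_of_mem galoisVertex rfl P Q

/-- A pair through `𝔈` or `𝒳` that does NOT end at `𝔈` goes through `𝒳`: both paths are `[σ]∘[γᵢ]` with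
`γ₁, γ₂` co-verticial into `𝒳`. [cite: MochizukiAbsTopIII2015, Cor 3.7 (i) p.87] -/
theorem exists_through_ref_of_univE₂ {a b : Cor37Vertex} {P Q : Path a b} (h : univE coreVertices₂ P Q)
    (hb : b ≠ .galois) :
    ∃ (p q : Path a .ref) (s : Path Cor37Vertex.ref b), P = p.comp s ∧ Q = q.comp s := by
  obtain ⟨w, hw, p, q, s, rfl, rfl⟩ := Classical.choice h
  rcases hw with rfl | rfl
  · exact absurd (eq_of_path_of_isEmpty_hom isEmpty_hom_galois s) hb
  · exact ⟨p, q, s, rfl, rfl⟩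

/-- Hence such a pair has ONE functor. [cite: MochizukiAbsTopIII2015, Cor 3.7 (i) p.87] -/
theorem pathFunctor_eq_of_univE₂ {a b : Cor37Vertex} {P Q : Path a b} (h : univE coreVertices₂ P Q)
    (hb : b ≠ .galois) : 𝔖.starDiagram.pathFunctor P = 𝔖.starDiagram.pathFunctor Q := by
  obtain ⟨p, q, s, rfl, rfl⟩ := exists_through_ref_of_univE₂ h hb
  exact 𝔖.pathFunctor_comp_eq_of_through_ref p q s

/-- `K₀`'s homotopy on a pair `(P, Q)` ending at `𝔈` with `P = [σ]∘[γ₁]`, `Q = [σ]∘[γ₂]`, `γᵢ` into `𝒳`, is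
the `eqToHom` (p446533, with the decomposition as hypotheses). [cite: MochizukiAbsTopIII2015, Cor 3.7 (iii) p.88] -/
theorem coresFamily_η_eq_eqToHom_of_eq_comp {a : Cor37Vertex} {P Q : Path a .galois} (p q : Path a .ref)
    (s : Path Cor37Vertex.ref .galois) (hP : P = p.comp s) (hQ : Q = q.comp s) (h : 𝔖.coresFamily.E P Q)
    (e : 𝔖.starDiagram.pathFunctor P = 𝔖.starDiagram.pathFunctor Q) :
    𝔖.coresFamily.η h = eqToHom e := by
  subst hP hQ
  exact 𝔖.coresFamily_η_eq_eqToHom_of_through_ref p q s h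

/-- Whiskering an `eqToHom` between equal functors on both sides gives the `eqToHom`. [folklore] -/
private theorem whisker_eqToHom {C₀ C₁ C₂ C₃ : Type u} [Category.{u} C₀] [Category.{u} C₁]
    [Category.{u} C₂] [Category.{u} C₃] (R₁ : C₀ ⥤ C₁) {P Q : C₁ ⥤ C₂} (R₂ : C₂ ⥤ C₃) (h : P = Q) :
    Functor.whiskerLeft R₁ (Functor.whiskerRight (eqToHom h) R₂) = eqToHom (by rw [h]) := by
  subst h
  simp

/-! ## The glue family `K₁` -/

open Classical in
/-- The homotopies of the glue family: `K₀`'s on pairs ending at `𝔈`, the identity on the others (which go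
through `𝒳` and have equal functors). [cite: MochizukiAbsTopIII2015, Cor 3.7 (iii) p.88] -/
noncomputable def glueη ⦃a b : Cor37Vertex⦄ ⦃P Q : Path a b⦄ (h : univE coreVertices₂ P Q) :
    𝔖.starDiagram.pathFunctor P ⟶ 𝔖.starDiagram.pathFunctor Q :=
  if hK : 𝔖.coresFamily.E P Q then 𝔖.coresFamily.η hK
  else eqToHom (𝔖.pathFunctor_eq_of_univE₂ h fun hb => hK ((𝔖.coresFamily_E_iff P Q).2 hb))

/-- On pairs ending at `𝔈`, `glueη` is `K₀`'s homotopy. [cite: MochizukiAbsTopIII2015, Cor 3.7 (iii) p.88] -/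
theorem glueη_of_E {a b : Cor37Vertex} {P Q : Path a b} (h : univE coreVertices₂ P Q)
    (hK : 𝔖.coresFamily.E P Q) : 𝔖.glueη h = 𝔖.coresFamily.η hK := by
  rw [glueη, dif_pos hK]

/-- On pairs not ending at `𝔈`, `glueη` is the identity `eqToHom`. [cite: MochizukiAbsTopIII2015, Cor 3.7 (iii) p.88] -/
theorem glueη_of_not {a b : Cor37Vertex} {P Q : Path a b} (h : univE coreVertices₂ P Q) (hb : b ≠ .galois) :
    𝔖.glueη h = eqToHom (𝔖.pathFunctor_eq_of_univE₂ h hb) := by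
  rw [glueη, dif_neg fun hK => hb ((𝔖.coresFamily_E_iff P Q).1 hK)]

/-- **The glue family `K₁` on `𝒟*`**: boundary set = pairs through `𝔈` or through `𝒳` (saturated,
`isSaturated_univE`); homotopies `glueη`. The laws: on pairs ending at `𝔈` they are `K₀`'s laws; elsewhere the
`eqToHom` calculus; in the mixed whiskering case (a pair through `𝒳` whiskered into `𝔈`) the two prescriptions
agree by `coresFamily_η_eq_eqToHom_of_through_ref`. [cite: MochizukiAbsTopIII2015, Cor 3.7 (iii) p.88] -/
noncomputable def glueFamily : 𝔖.starDiagram.HomotopyFamily where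
  E := univE coreVertices₂
  isSaturated := isSaturated_univE coreVertices₂
  η := 𝔖.glueη
  η_refl := by
    intro a b P h
    by_cases hb : b = .galois
    · rw [𝔖.glueη_of_E h ((𝔖.coresFamily_E_iff P P).2 hb)]
      exact 𝔖.coresFamily.η_refl _
    · rw [𝔖.glueη_of_not h hb, eqToHom_refl]
  η_trans := by
    intro a b P Q R h₁ h₂
    by_cases hb : b = .galois
    · rw [𝔖.glueη_of_E h₁ ((𝔖.coresFamily_E_iff P Q).2 hb), 𝔖.glueη_of_E h₂ ((𝔖.coresFamily_E_iff Q R).2 hb),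
        𝔖.glueη_of_E _ ((𝔖.coresFamily_E_iff P R).2 hb), ← 𝔖.coresFamily.η_trans]
    · rw [𝔖.glueη_of_not h₁ hb, 𝔖.glueη_of_not h₂ hb, 𝔖.glueη_of_not _ hb, eqToHom_trans]
  η_whisker := by
    intro a b c d P Q h r₁ r₂
    by_cases hd : d = .galois
    · subst hd
      by_cases hb : b = .galois
      · subst hb
        obtain rfl : r₂ = Path.nil := path_eq_nil_of_isEmpty_hom isEmpty_hom_galois r₂
        have hK : 𝔖.coresFamily.E P Q := (𝔖.coresFamily_E_iff P Q).2 rfl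
        rw [𝔖.glueη_of_E h hK, 𝔖.glueη_of_E _ ((𝔖.coresFamily_E_iff _ _).2 rfl)]
        exact 𝔖.coresFamily.η_whisker hK r₁ Path.nil
      · obtain ⟨p, q, s, rfl, rfl⟩ := exists_through_ref_of_univE₂ h hb
        rw [𝔖.glueη_of_not h hb, whisker_eqToHom, eqToHom_trans, eqToHom_trans,
          𝔖.glueη_of_E _ ((𝔖.coresFamily_E_iff _ _).2 rfl)]
        exact 𝔖.coresFamily_η_eq_eqToHom_of_eq_comp (r₁.comp p) (r₁.comp q) (s.comp r₂)
          (by rw [Path.comp_assoc, Path.comp_assoc]) (by rw [Path.comp_assoc, Path.comp_assoc]) _ _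
    · have hb : b ≠ .galois := by
        rintro rfl
        exact hd (eq_of_path_of_isEmpty_hom isEmpty_hom_galois r₂)
      rw [𝔖.glueη_of_not h hb, 𝔖.glueη_of_not _ hd, whisker_eqToHom, eqToHom_trans, eqToHom_trans]

/-- The boundary set of `K₁` (definitional). [cite: MochizukiAbsTopIII2015, Cor 3.7 (iii) p.88] -/
theorem glueFamily_E_iff {a b : Cor37Vertex} (P Q : Path a b) :
    𝔖.glueFamily.E P Q ↔ univE coreVertices₂ P Q := Iff.rfl

/-! ## The `𝒳`-core presentation IS the pulled-back diagram `embRefCore^*𝒟*` -/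

/-- `𝒟‡_{≤1} = 𝒟†_{≤1} ∪ {𝒳}` IS `embRefCore^*𝒟*`. [cite: MochizukiAbsTopIII2015, Cor 3.7 (i) p.87] -/
theorem refCoreDiagram_eq_comapAlong :
    (𝔖.daggerLe 1).extend 𝔖.refCoreExt = 𝔖.starDiagram.comapAlong embRefCore :=
  𝔖.starDiagram.eq_comapAlong embRefCore (fun a => by rcases a with _ | _ <;> rfl)
    (fun a => by rcases a with _ | _ <;> exact HEq.rfl)
    (fun e => by
      rename_i a b
      revert e
      rcases a with ⟨_ | _ | _ | _ | _, _⟩ | _ <;> rcases b with _ | _ <;> intro e <;>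
        first | exact (PEmpty.elim e) | exact HEq.rfl)

/-- The pullback of a family `K` on `𝒟*` to `𝒟‡_{≤1}`. [cite: MochizukiAbsTopIII2015, Cor 3.7 (i) p.87] -/
noncomputable def pullRefCore (K : 𝔖.starDiagram.HomotopyFamily) :
    ((𝔖.daggerLe 1).extend 𝔖.refCoreExt).HomotopyFamily :=
  𝔖.refCoreDiagram_eq_comapAlong.symm ▸ K.comap embRefCore

/-- Its boundary set. [cite: MochizukiAbsTopIII2015, Cor 3.7 (i) p.87] -/
theorem pullRefCore_E_iff (K : 𝔖.starDiagram.HomotopyFamily) {a b : refCoreShape.{u}.Vertex}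
    (p q : Path a b) : (𝔖.pullRefCore K).E p q ↔ K.E (embRefCore.mapPath p) (embRefCore.mapPath q) :=
  HomotopyFamily.cast_E_iff _ _ p q

/-- Its compatibility with `K`. [cite: MochizukiAbsTopIII2015, Cor 3.7 (i) p.87] -/
theorem pullRefCore_compatibleAlong (K : 𝔖.starDiagram.HomotopyFamily) :
    (𝔖.pullRefCore K).CompatibleAlong embRefCore K :=
  fun _ _ p q hE => K.cast_comap_compatible embRefCore 𝔖.refCoreDiagram_eq_comapAlong.symm p q hE

/-- The core vertex of `𝒟‡_{≤1}` has no outgoing edges. [cite: MochizukiAbsTopIII2015, Cor 3.7 (i) p.87] -/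
theorem isEmpty_hom_refCoreObs (b : refCoreShape.{u}.Vertex) : IsEmpty (refCoreShape.{u}.obs ⟶ b) := by
  rcases b with _ | _ <;> exact ⟨fun e => PEmpty.elim e⟩

/-- Every vertex of `𝒟†_{≤1}` reaches the core vertex `𝒳` (via `π_⋎`; abc-iut-L4-t9's `refCoreObs_isCore`).
[cite: MochizukiAbsTopIII2015, Cor 3.7 (i) p.87] -/
theorem refCore_reaches (a : SubVertex {a : Cor37Vertex | a.InDaggerLe 1}) :
    Nonempty (Path (refCoreShape.{u}.base a) refCoreShape.{u}.obs) := by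
  obtain ⟨a, ha⟩ := a
  cases a with
  | first n => exact ⟨(Path.nil : Path (refCoreShape.{u}.base ⟨.first n, ha⟩) _).cons PUnit.unit⟩
  | box => exact False.elim (by simpa [Cor37Vertex.row] using ha.2)
  | space => exact False.elim (by simpa [Cor37Vertex.row] using ha.2)
  | galois => exact False.elim (by simpa [Cor37Vertex.row] using ha.2)
  | ref => exact False.elim (ha.1 rfl)

/-! ## Cor. 3.7 (iii), second clause: the cores of (i), (ii) in ONE family — PROVED for every setting -/

/-- **`K₁` realises the `𝔈`-core of `𝒟†_{≤4}`, the `𝒳`-core of `𝒟‡_{≤1}` and the `𝔈`-core of `𝒟*` at once**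
(three of the four conjuncts of `RealisesCoresAndLogObs K₁`): its pulled-back pairs ending at the respective core
vertex are ALL co-verticial pairs, and the pulled-back families are compatible with `K₁` along the embeddings by
construction. [cite: MochizukiAbsTopIII2015, Cor 3.7 (iii) p.88] -/
theorem glueFamily_realises_cores_and_refCore :
    (∃ H hH, (𝔖.galCoreObs H hH).IsCore ∧ H.CompatibleAlong embGalCore 𝔖.glueFamily) ∧
    (∃ H hH, (𝔖.refCoreObs H hH).IsCore ∧ H.CompatibleAlong embRefCore 𝔖.glueFamily) ∧
    (∃ H hH, (𝔖.starGalCoreObs H hH).IsCore ∧ H.CompatibleAlong embStarCore 𝔖.glueFamily) := by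
  refine ⟨⟨(𝔖.pullGalCore 𝔖.glueFamily).endingAt _ isEmpty_hom_galCoreObs, fun _ _ _ _ h => h.1,
      ⟨fun _ p q => ⟨rfl, (𝔖.pullGalCore_E_iff _ p q).mpr
        (univE_of_mem coreVertices₂ (Or.inl rfl) (embGalCore.mapPath p) (embGalCore.mapPath q))⟩,
        galCore_reaches⟩,
      HomotopyFamily.endingAt_compatibleAlong _ _ _ (𝔖.pullGalCore_compatibleAlong _) _ _⟩,
    ⟨(𝔖.pullRefCore 𝔖.glueFamily).endingAt _ isEmpty_hom_refCoreObs, fun _ _ _ _ h => h.1,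
      ⟨fun _ p q => ⟨rfl, (𝔖.pullRefCore_E_iff _ p q).mpr
        (univE_of_mem coreVertices₂ (Or.inr rfl) (embRefCore.mapPath p) (embRefCore.mapPath q))⟩,
        refCore_reaches⟩,
      HomotopyFamily.endingAt_compatibleAlong _ _ _ (𝔖.pullRefCore_compatibleAlong _) _ _⟩,
    ⟨(𝔖.pullStarCore 𝔖.glueFamily).endingAt _ isEmpty_hom_starCoreObs, fun _ _ _ _ h => h.1,
      ⟨fun _ p q => ⟨rfl, (𝔖.pullStarCore_E_iff _ p q).mpr
        (univE_of_mem coreVertices₂ (Or.inl rfl) (embStarCore.mapPath p) (embStarCore.mapPath q))⟩,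
        starGalCore_reaches⟩,
      HomotopyFamily.endingAt_compatibleAlong _ _ _ (𝔖.pullStarCore_compatibleAlong _) _ _⟩⟩

/-- **Cor. 3.7 (iii), second clause — cores part, for EVERY setting**: ONE family of homotopies on `𝒟*` contains
the core structures of (i) (`(𝒟†_{≤4}, 𝔈)`, `(𝒟‡_{≤1}, 𝒳)`) and of (ii) (`(𝒟*, 𝔈)`); what remains of
`LogObsCompatCoresStmt` is the `𝔖†_log` conjunct (needs an `ι`-over-Galois hypothesis; plan step (2)).
[cite: MochizukiAbsTopIII2015, Cor 3.7 (iii) p.88] -/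
theorem exists_realises_cores_and_refCore : ∃ K : 𝔖.starDiagram.HomotopyFamily,
    (∃ H hH, (𝔖.galCoreObs H hH).IsCore ∧ H.CompatibleAlong embGalCore K) ∧
    (∃ H hH, (𝔖.refCoreObs H hH).IsCore ∧ H.CompatibleAlong embRefCore K) ∧
    (∃ H hH, (𝔖.starGalCoreObs H hH).IsCore ∧ H.CompatibleAlong embStarCore K) :=
  ⟨𝔖.glueFamily, 𝔖.glueFamily_realises_cores_and_refCore⟩

end BiAnabelianSetting

end Literature.AnabelianGeometry.AbsoluteAnabelian.AbsTopIII
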